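import Literature.AlgebraicGeometry.HodgeTheory.MaxRationalSubHodgeStructureKunnethNeronSeveriPieces
import HarnessLib

/-!
# The transcendental pieces `Hⁱ(X) ⊗ T(S)_ℂ`: splitting the Künneth component `max(X × S, i + 2, r) ∩ (Hⁱ(X) ⊗ H²(S))`
# into its Néron–Severi and transcendental parts; `GHC` and `HC` for `X × S` (`S` a K3-type surface) modulo
# the transcendental pieces alone

Family `hodge`, layer `Literature/AlgebraicGeometry/HodgeTheory`; lane `lit-hodgefound` (Track 2 foundations,
Layer A1/A4). THEOREMS ONLY (no definition, no named fact; D-0026). Sequel of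
`MaxRationalSubHodgeStructureKunnethNeronSeveriPieces` (`H²(S, ℂ) = NS(S)_ℂ ⊕ T(S)_ℂ` with
`T(S)_ℂ := NS(S)_ℂ^⊥` for the intersection form, `isCompl_algebraicClasses_orthogonal`; algebraic Poincaré-dual
classes `exists_dual_family_algebraicClasses_one`; admissible subspaces of `Hⁱ(X) ⊠ NS(S)_ℂ` settled by `GHC(X, i, r − 1)`).

Sources, VERBATIM. A. Grothendieck, *Hodge's general conjecture is false for trivial reasons*, Topology 8 (1969),
p. 300 («the largest sub-space of [`Fʳ Hᵏ ∩ Hᵏ(X, ℚ)`], generating a subspace of `Hᵏ(X^an, ℂ)` which is a sub-Hodge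
structure») — for `X = E × E`, `S = E × E'` the transcendental pieces are where his counterexample to the un-amended
statement lives. D. Huybrechts, *Lectures on K3 Surfaces* (CUP 2016), Ch. 3 §3.2–§3.3 (the transcendental lattice
`T(X) := NS(X)^⊥`). C. Voisin, *Hodge Theory and Complex Algebraic Geometry I* (CUP 2002), §11.3.3 Thm. 11.38 and
p. 287 (11.11): «`p_{1*}(p_1^* α ∪ p_2^*[Y]) = α`». R. Hartshorne, *Algebraic Geometry* (1977), V Thm. 1.9 / Rem. 1.9.1
(Hodge index: the intersection form on `Num S` is non-degenerate).

## The splitting (§3)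

For `w ∈ max(X × S, k, r) ∩ (Hⁱ(X) ⊗ H²(S))`, `k = i + 2`, `r = c + 1`, write `w = w₁ + w₂` along
`Hⁱ(X) ⊗ H²(S) = Hⁱ(X) ⊠ NS(S)_ℂ + Hⁱ(X) ⊠ T(S)_ℂ` and `w₁ = Σ_t pr_X^* a_t ∪ pr_S^* ν_t` in a basis `(ν_t)` of `NS(S)_ℂ`
with algebraic Poincaré duals `ν'_u ∈ NS(S)_ℂ`. The operators `Ψ_u := pr_{X*}(− ∪ pr_S^* ν'_u)` kill `Hⁱ(X) ⊠ T(S)_ℂ`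
(`T ⊥ NS`, §1) and give `Ψ_u(w) = λ a_u`; since `ν'_u` is a combination of rational `(1,1)` classes, `Ψ_u` maps the
admissible `max(X × S, k, c + 1)` into `max(X, i, c)` (§2). Hence `a_u ∈ max(X, i, c) ⊆ Nᶜ Hⁱ(X)` by `GHC(X, i, c)`,
`w₁ ∈ max(X, i, c) ⊠ NS(S)_ℂ ⊆ max(X × S, k, c + 1) ∩ N^{c+1}`, and `w₂ = w − w₁ ∈ max(X × S, k, c + 1) ∩ (Hⁱ(X) ⊠ T(S)_ℂ)`:
**the component over `Hⁱ(X) ⊗ H²(S)` lies in `Nʳ` iff its transcendental part does, granted `GHC(X, i, r − 1)`**.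

## What is proved

* §1 `exists_complexGysin_fst_cross_cup_map_snd_eq_smul` (`Ψ_{ν'}(pr_X^* a ∪ pr_Y^* ν) = ⟨ν ∪ ν', [Y]⟩ λ a`),
  `complexGysin_fst_cupProduct_map_snd_eq_zero_of_mem_map₂_cross` (`Ψ_{ν'}` kills `Hⁱ(X) ⊠ T` for `T ⊥ ν'`).
* §2 `HodgeModel.map_complexGysin_fst_cupProduct_map_snd_le_maxRatSubHodgeInFilt` and its span form (`Ψ_ρ` maps
  admissible subspaces of level `c + b` of `X × Y` into `max(X, i, c)`, `ρ` rational of type `(e, e)`, `b + e = m`).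
* §3 **`maxRatSubHodgeInFilt_inf_kunnethPiece_le_supportedClasses_of_transcendental`** (THE SPLITTING, `S` any smooth
  projective surface) and the `iff` form `maxRatSubHodgeInFilt_inf_kunnethPiece_le_supportedClasses_iff_transcendental`.
* §4 **`generalHodgePropertyFor_tensor_surface_of_transcendental`** — for a surface `S` with `H¹(S) = H³(S) = 0` (K3
  surfaces, …): `GHC(X, k, r) ∧ GHC(X, k − 2, r − 1) ∧ GHC(X, k − 4, r − 2) ∧ [transcendental piece of level r] ⟹
  GHC(X × S, k, r)`; **`hodgeConjectureFor_tensor_surface_of_transcendental`** — `HC(X) ∧ [the Hodge-class part of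
  max(X × S, 2p, p) inside H^{2p−2}(X) ⊠ T(S)_ℂ is algebraic for every p] ⟹ HC(X × S)`.
* §5 THE `iff` FORMS WITH THE KNOWN BIDEGREES DISCHARGED (`GHC(Z, 2p, p)` for `p ≤ 1` or `p + 1 ≥ dim Z`,
  `generalHodgePropertyFor_two_mul_self_of_lefschetzRange`; `HC` in dimension `≤ 3`, `hodgeConjectureFor_of_dim_le_three_holds`):
  **`hodgeConjectureFor_tensor_surface_iff_transcendental`** (`HC(X × S) ⟺` the transcendental pieces at `(2p, p)`,
  `2 ≤ p ≤ dim X`, granted `HC(X)`), **`hodgeConjectureFor_surface_tensor_surface_iff_transcendental`** (TWO SURFACES: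
  `HC(S₁ × S₂) ⟺ max(S₁ × S₂, 4, 2) ∩ (H²(S₁) ⊠ T(S₂)_ℂ) ⊆ N²`, unconditionally),
  `hodgeConjectureFor_threefold_tensor_surface_iff_transcendental`, and
  **`forall_generalHodgePropertyFor_curve_tensor_surface_iff_transcendental`** (`GHC(C × S, i, r)` for ALL `(i, r)`
  `⟺ max(C × S, 3, 1) ∩ (H¹(C) ⊠ T(S)_ℂ) ⊆ N¹` — Grothendieck's problem for `C × S` is exactly its transcendental piece).

## References

* [GrothendieckTopology1969] A. Grothendieck, Hodge's general conjecture is false for trivial reasons, Topology 8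
  (1969) 299–303, p. 300.
* [Huybrechts2016K3] D. Huybrechts, Lectures on K3 Surfaces (CUP 2016), Ch. 3 §3.2–§3.3.
* [VoisinHodgeI2002] C. Voisin, Hodge Theory and Complex Algebraic Geometry I (CUP 2002), §11.3.3 Thm. 11.38,
  Thm. 11.40 and p. 287 (11.11).
* [Hartshorne1977] R. Hartshorne, Algebraic Geometry, GTM 52 (Springer 1977), V Thm. 1.9 and V Rem. 1.9.1.
* [HatcherAT2002] A. Hatcher, Algebraic Topology (CUP 2002), §3.3 Prop. 3.38.
* [VoisinHodgeII2003] C. Voisin, Hodge Theory and Complex Algebraic Geometry II (CUP 2003), §10.2.3 proof of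
  Prop. 10.26.
-/

noncomputable section

open CategoryTheory AlgebraicGeometry MonoidalCategory CartesianMonoidalCategory Finset
open Literature.AlgebraicTopology.SingularHomology
open Literature.Geometry.Kaehler
open Literature.AlgebraicGeometry.Motives (IsSmoothProjective ComplexPoints)

namespace Literature.AlgebraicGeometry.HodgeTheory

variable {n m : ℕ} {X Y : Motives.SchemeOver ℂ}

/-! ### §1 `Ψ_{ν'} ∘ Φ_ν = ⟨ν ∪ ν', [Y]⟩ λ` -/

/-- **`pr_{X*}((pr_X^* a ∪ pr_Y^* ν) ∪ pr_Y^* ν') = ⟨ν ∪ ν', [Y]⟩ λ a`** for a non-zero scalar `λ` depending only on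
`X`, `Y` (projection formula and the fibre integral `pr_{X*} pr_Y^* ω = ⟨ω, [Y]⟩ λ 1`).
[cite: VoisinHodgeI2002, §11.3.3 p. 287 (11.11) and §7.3.2] [cite: HatcherAT2002, §3.3 Prop. 3.38] -/
theorem exists_complexGysin_fst_cross_cup_map_snd_eq_smul (hX : IsSmoothProjective n X) (hY : IsSmoothProjective m Y)
    {i b e k : ℕ} (hbe : b + e = m) (hk : i + 2 * b = k) :
    ∃ lam : ℂ, lam ≠ 0 ∧ ∀ (a : complexBetti X i) (ν : complexBetti Y (2 * b)) (ν' : complexBetti Y (2 * e)),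
      complexGysin complexOrientationFamily (hX.tensor_holds hY) hX (fst X Y)
          (show (k + 2 * e) + 2 * n = i + 2 * (n + m) by omega)
        (cupProduct (rfl : k + 2 * e = k + 2 * e)
          (cupProduct hk (complexBetti.map (fst X Y) i a) (complexBetti.map (snd X Y) (2 * b) ν))
          (complexBetti.map (snd X Y) (2 * e) ν')) =
        (kroneckerPairing ℂ ℂ (ComplexPoints Y) (2 * m) (cupProduct (show 2 * b + 2 * e = 2 * m by omega) ν ν')
          (complexOrientationFamily hY).fundamentalClass * lam) • a := by
  obtain ⟨lam, hlam0, hlam⟩ := exists_complexGysin_fst_map_snd_eq_kroneckerPairing_smul hX hY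
  refine ⟨lam, hlam0, fun a ν ν' ↦ ?_⟩
  rw [complexGysin_fst_cross_cup_map_snd complexOrientationFamily hX hY hbe hk a ν ν', hlam, map_smul, cupProduct_one]

/-- **`Ψ_{ν'}` kills `Hⁱ(X) ⊠ T` when `T ⊥ ν'`**: if `⟨τ ∪ ν', [Y]⟩ = 0` for all `τ ∈ T`, then
`pr_{X*}(w ∪ pr_Y^* ν') = 0` for every `w ∈ Hⁱ(X) ⊠ T`. [cite: VoisinHodgeI2002, §11.3.3 p. 287 (11.11)]
[cite: Huybrechts2016K3, Ch. 3 §3.2–§3.3] -/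
theorem complexGysin_fst_cupProduct_map_snd_eq_zero_of_mem_map₂_cross (hX : IsSmoothProjective n X)
    (hY : IsSmoothProjective m Y) {i b e k : ℕ} (hbe : b + e = m) (hk : i + 2 * b = k)
    {T : Submodule ℂ (complexBetti Y (2 * b))} {ν' : complexBetti Y (2 * e)}
    (hT : ∀ τ ∈ T, kroneckerPairing ℂ ℂ (ComplexPoints Y) (2 * m)
      (cupProduct (show 2 * b + 2 * e = 2 * m by omega) τ ν') (complexOrientationFamily hY).fundamentalClass = 0)
    {w : complexBetti (X ⊗ Y) k}
    (hw : w ∈ Submodule.map₂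
      ((cupProduct hk).compl₁₂ (complexBetti.map (fst X Y) i).hom (complexBetti.map (snd X Y) (2 * b)).hom) ⊤ T) :
    complexGysin complexOrientationFamily (hX.tensor_holds hY) hX (fst X Y)
        (show (k + 2 * e) + 2 * n = i + 2 * (n + m) by omega)
      (cupProduct (rfl : k + 2 * e = k + 2 * e) w (complexBetti.map (snd X Y) (2 * e) ν')) = 0 := by
  obtain ⟨lam, -, hlam⟩ := exists_complexGysin_fst_cross_cup_map_snd_eq_smul hX hY hbe hk
  rw [map₂_cross_eq_span] at hw
  induction hw using Submodule.span_induction with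
  | mem v hv =>
    obtain ⟨a, -, τ, hτ, rfl⟩ := hv
    rw [hlam a τ ν', hT τ hτ, zero_mul, zero_smul]
  | zero => rw [LinearMap.map_zero₂, map_zero]
  | add x y _ _ hx hy => rw [LinearMap.map_add₂, map_add, hx, hy, add_zero]
  | smul c x _ hx => rw [LinearMap.map_smul₂, map_smul, hx, smul_zero]

/-! ### §2 `Ψ_ρ` maps admissible subspaces of `X × Y` into `max(X, i, c)` -/

/-- **`Ψ_ρ(W) ⊆ max(X, i, c)`** for `W` admissible of level `c + b` in `Hᵏ((X ⊗ Y)(ℂ); ℂ)`, `k = i + 2b`, and `ρ` a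
rational class of type `(e, e)` on `Y`, `b + e = m`: cup product with `pr_Y^* ρ` raises the level to `c + m`
(`HodgeModel.map_cupProduct_map_snd_mem_ratSubHodgeInFilt`) and `pr_{X*}` lowers it by `m`
(`HodgeModel.complexGysin_map_mem_ratSubHodgeInFilt`). [cite: GrothendieckTopology1969, p. 300]
[cite: VoisinHodgeI2002, §11.3.3 p. 287 (11.11) and Thm. 11.40] -/
theorem HodgeModel.map_complexGysin_fst_cupProduct_map_snd_le_maxRatSubHodgeInFilt (hX : IsSmoothProjective n X)
    (hY : IsSmoothProjective m Y) (A : HodgeModel n X) (C : HodgeModel (n + m) (X ⊗ Y)) {i b e k c : ℕ}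
    (hbe : b + e = m) (hk : i + 2 * b = k) {ρ : complexBetti Y (2 * e)} (hρQ : IsRationalClass ρ)
    (hρT : IsOfHodgeType m Y (2 * e) e e ρ) {W : Submodule ℂ (complexBetti (X ⊗ Y) k)}
    (hW : W ∈ C.ratSubHodgeInFilt k (c + b)) :
    (W.map ((cupProduct (rfl : k + 2 * e = k + 2 * e)).flip (complexBetti.map (snd X Y) (2 * e) ρ))).map
        (complexGysin complexOrientationFamily (hX.tensor_holds hY) hX (fst X Y)
          (show (k + 2 * e) + 2 * n = i + 2 * (n + m) by omega)) ≤ A.maxRatSubHodgeInFilt i c := by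
  have h1 : W.map ((cupProduct (rfl : k + 2 * e = k + 2 * e)).flip (complexBetti.map (snd X Y) (2 * e) ρ)) ∈
      C.ratSubHodgeInFilt (k + 2 * e) (c + m) := by
    have h := C.map_cupProduct_map_snd_mem_ratSubHodgeInFilt hX hY (rfl : k + 2 * e = k + 2 * e) hρQ hρT hW
    rwa [show c + b + e = c + m by omega] at h
  exact A.le_maxRatSubHodgeInFilt
    (C.complexGysin_map_mem_ratSubHodgeInFilt A (hX.tensor_holds hY) hX (fst X Y) (r := m) rfl _ h1)

/-- **`Ψ_{ν''}(w) ∈ max(X, i, c)`** for `w` in an admissible `W` of level `c + b` and `ν''` in the span of the rational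
`(e, e)` classes of `Y` (e.g. `ν'' ∈ Nᵉ H^{2e}(Y)`, `algebraicClasses_le_span_hodgeClasses`).
[cite: GrothendieckTopology1969, p. 300] [cite: VoisinHodgeI2002, §11.3.3 p. 287 (11.11)] -/
theorem HodgeModel.complexGysin_fst_cupProduct_map_snd_mem_maxRatSubHodgeInFilt (hX : IsSmoothProjective n X)
    (hY : IsSmoothProjective m Y) (A : HodgeModel n X) (C : HodgeModel (n + m) (X ⊗ Y)) {i b e k c : ℕ}
    (hbe : b + e = m) (hk : i + 2 * b = k) {W : Submodule ℂ (complexBetti (X ⊗ Y) k)}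
    (hW : W ∈ C.ratSubHodgeInFilt k (c + b)) {w : complexBetti (X ⊗ Y) k} (hw : w ∈ W)
    {ν'' : complexBetti Y (2 * e)}
    (hν'' : ν'' ∈ Submodule.span ℂ {ρ : complexBetti Y (2 * e) | IsRationalClass ρ ∧ IsOfHodgeType m Y (2 * e) e e ρ}) :
    complexGysin complexOrientationFamily (hX.tensor_holds hY) hX (fst X Y)
        (show (k + 2 * e) + 2 * n = i + 2 * (n + m) by omega)
      (cupProduct (rfl : k + 2 * e = k + 2 * e) w (complexBetti.map (snd X Y) (2 * e) ν'')) ∈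
        A.maxRatSubHodgeInFilt i c := by
  induction hν'' using Submodule.span_induction with
  | mem ρ hρ =>
    exact A.map_complexGysin_fst_cupProduct_map_snd_le_maxRatSubHodgeInFilt hX hY C hbe hk hρ.1 hρ.2 hW
      ⟨_, ⟨w, hw, rfl⟩, rfl⟩
  | zero =>
    rw [map_zero, map_zero, map_zero]
    exact Submodule.zero_mem _
  | add x y _ _ hx hy =>
    rw [map_add, map_add, map_add]
    exact Submodule.add_mem _ hx hy
  | smul t x _ hx =>
    rw [map_smul, map_smul, map_smul]
    exact Submodule.smul_mem _ t hx

/-! ### §3 The splitting of the component over `Hⁱ(X) ⊗ H²(S)` -/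

/-- **THE SPLITTING — the component of `max(X × S, i + 2, r)` in the Künneth piece `Hⁱ(X) ⊗ H²(S)` lies in `Nʳ` as soon
as `GHC(X, i, r − 1)` holds AND its TRANSCENDENTAL part `max(X × S, i + 2, r) ∩ (Hⁱ(X) ⊠ T(S)_ℂ)` lies in `Nʳ`**
(`T(S)_ℂ = NS(S)_ℂ^⊥`; `S` any smooth projective surface, `X` any smooth projective variety). Proof in the module
docstring. [cite: GrothendieckTopology1969, p. 300] [cite: Huybrechts2016K3, Ch. 3 §3.2–§3.3]
[cite: Hartshorne1977, V Thm. 1.9 and V Rem. 1.9.1] [cite: VoisinHodgeI2002, §11.3.3 Thm. 11.38 and p. 287 (11.11)] -/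
theorem maxRatSubHodgeInFilt_inf_kunnethPiece_le_supportedClasses_of_transcendental {S : Motives.SchemeOver ℂ}
    (hX : IsSmoothProjective n X) (hS : IsSmoothProjective 2 S) (C : HodgeModel (n + 2) (X ⊗ S)) {i k r : ℕ}
    (hk : i + 2 * 1 = k) (hG : 1 ≤ r → GeneralHodgePropertyFor n X i (r - 1))
    (hT : C.maxRatSubHodgeInFilt k r ⊓ Submodule.map₂
        ((cupProduct hk).compl₁₂ (complexBetti.map (fst X S) i).hom (complexBetti.map (snd X S) (2 * 1)).hom) ⊤
        (LinearMap.BilinForm.orthogonal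
          (cupPairing (complexOrientationFamily hS) (show 2 * 1 + 2 * 1 = 2 * 2 by omega)) (algebraicClasses S 1)) ≤
      supportedClasses (X ⊗ S) k r) :
    C.maxRatSubHodgeInFilt k r ⊓ kunnethPiece X S hk ≤ supportedClasses (X ⊗ S) k r := by
  classical
  rcases Nat.eq_zero_or_pos r with rfl | hr
  · rw [supportedClasses_zero]
    exact le_top
  obtain ⟨c, rfl⟩ : ∃ c, r = c + 1 := ⟨r - 1, by omega⟩
  have hGc : GeneralHodgePropertyFor n X i c := by
    have h := hG hr
    rwa [Nat.add_sub_cancel] at h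
  obtain ⟨A⟩ := hGc.1
  obtain ⟨B⟩ := nonempty_hodgeModel_holds hS
  have hXS := hX.tensor_holds hS
  haveI := finite_complexBetti hS (2 * 1)
  -- notation-free abbreviations
  set cross := (cupProduct hk).compl₁₂ (complexBetti.map (fst X S) i).hom (complexBetti.map (snd X S) (2 * 1)).hom
    with hcross
  set NS := algebraicClasses S 1 with hNS
  set T := LinearMap.BilinForm.orthogonal
    (cupPairing (complexOrientationFamily hS) (show 2 * 1 + 2 * 1 = 2 * 2 by omega)) NS with hTdef
  -- a basis of `NS(S)_ℂ`, its algebraic Poincaré duals, the fibre-integral scalar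
  set β := Module.finBasis ℂ ↥NS with hβ
  obtain ⟨ν', hν'N, hdual⟩ := exists_dual_family_algebraicClasses_one hS β
  obtain ⟨lam, hlam0, hlam⟩ := exists_complexGysin_fst_cross_cup_map_snd_eq_smul hX hS (rfl : 1 + 1 = 2) hk
  -- `Ψ_u` kills `Hⁱ(X) ⊠ T`
  have hTorth : ∀ u, ∀ τ ∈ T, kroneckerPairing ℂ ℂ (ComplexPoints S) (2 * 2)
      (cupProduct (show 2 * 1 + 2 * 1 = 2 * 2 by omega) τ (ν' u)) (complexOrientationFamily hS).fundamentalClass = 0 := by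
    intro u τ hτ
    rw [← cupPairing_apply, cupPairing_comm_two hS]
    exact (LinearMap.BilinForm.mem_orthogonal_iff.1 hτ) (ν' u) (hν'N u)
  -- the decomposition `Hⁱ(X) ⊗ H²(S) = Hⁱ(X) ⊠ NS + Hⁱ(X) ⊠ T`
  have hpiece : kunnethPiece X S hk = Submodule.map₂ cross ⊤ NS ⊔ Submodule.map₂ cross ⊤ T := by
    rw [kunnethPiece_eq_map₂_cross_top_top, ← (isCompl_algebraicClasses_orthogonal hS).sup_eq_top,
      Submodule.map₂_sup_right]
  -- `max(X, i, c) ⊠ NS ⊆ max(X × S, k, c + 1) ∩ N^{c+1}`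
  have hW₁ : Submodule.map₂ cross (A.maxRatSubHodgeInFilt i c) NS ∈ C.ratSubHodgeInFilt k (c + 1) :=
    HodgeModel.map₂_cross_mem_ratSubHodgeInFilt hX hS A B C hk (A.maxRatSubHodgeInFilt_mem i c)
      (B.supportedClasses_mem_ratSubHodgeInFilt hS (2 * 1) 1)
  have hW₁N : Submodule.map₂ cross (A.maxRatSubHodgeInFilt i c) NS ≤ supportedClasses (X ⊗ S) k (c + 1) := by
    refine Submodule.map₂_le.2 fun a ha ν hν ↦ ?_
    rw [hcross, cross_compl₁₂_apply]
    exact cupProduct_map_fst_map_snd_mem_supportedClasses hX hS hk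
      ((generalHodgePropertyFor_iff_of_hodgeModel A hX i c).1 hGc ha) hν
  -- the splitting of a class of the component
  rintro w ⟨hwmax, hwpiece⟩
  rw [hpiece] at hwpiece
  obtain ⟨w₁, hw₁, w₂, hw₂, rfl⟩ := Submodule.mem_sup.1 hwpiece
  -- coordinates of `w₁` in the basis of `NS`
  have hw₁' : w₁ ∈ Submodule.map₂ cross ⊤ (Submodule.span ℂ (Set.range fun t ↦ (β t : complexBetti S (2 * 1)))) := by
    rwa [span_range_basis_algebraicClasses_eq β]
  obtain ⟨a, hwa⟩ := exists_eq_sum_cross_of_mem_map₂_cross_span hk (fun t ↦ (β t : complexBetti S (2 * 1))) hw₁'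
  -- `Ψ_u(w₁ + w₂) = λ a_u ∈ max(X, i, c)`
  have hΨ₂ : ∀ u, complexGysin complexOrientationFamily hXS hX (fst X S)
      (show (k + 2 * 1) + 2 * n = i + 2 * (n + 2) by omega)
      (cupProduct (rfl : k + 2 * 1 = k + 2 * 1) w₂ (complexBetti.map (snd X S) (2 * 1) (ν' u))) = 0 := fun u ↦
    complexGysin_fst_cupProduct_map_snd_eq_zero_of_mem_map₂_cross hX hS (rfl : 1 + 1 = 2) hk (hTorth u) hw₂
  have hΨ₁ : ∀ u, complexGysin complexOrientationFamily hXS hX (fst X S)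
      (show (k + 2 * 1) + 2 * n = i + 2 * (n + 2) by omega)
      (cupProduct (rfl : k + 2 * 1 = k + 2 * 1) w₁ (complexBetti.map (snd X S) (2 * 1) (ν' u))) = lam • a u := by
    intro u
    rw [hwa, map_sum, LinearMap.sum_apply, map_sum]
    rw [Finset.sum_congr rfl fun t _ ↦ hlam (a t) (β t : complexBetti S (2 * 1)) (ν' u)]
    rw [Finset.sum_congr rfl fun t _ ↦ by rw [hdual t u]]
    rw [Finset.sum_eq_single u (fun t _ htu ↦ by rw [if_neg htu, zero_mul, zero_smul])
      (fun h ↦ absurd (Finset.mem_univ u) h), if_pos rfl, one_mul]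
  have hau : ∀ u, a u ∈ A.maxRatSubHodgeInFilt i c := by
    intro u
    have h := A.complexGysin_fst_cupProduct_map_snd_mem_maxRatSubHodgeInFilt hX hS C (rfl : 1 + 1 = 2) hk
      (C.maxRatSubHodgeInFilt_mem k (c + 1)) hwmax (algebraicClasses_le_span_hodgeClasses hS 1 (hν'N u))
    rw [LinearMap.map_add₂, map_add, hΨ₁ u, hΨ₂ u, add_zero] at h
    have h' := Submodule.smul_mem _ lam⁻¹ h
    rwa [inv_smul_smul₀ hlam0] at h'
  -- `w₁ ∈ max(X, i, c) ⊠ NS`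
  have hw₁W₁ : w₁ ∈ Submodule.map₂ cross (A.maxRatSubHodgeInFilt i c) NS := by
    rw [hwa]
    refine Submodule.sum_mem _ fun t _ ↦ ?_
    rw [← cross_compl₁₂_apply hk, ← hcross]
    exact Submodule.apply_mem_map₂ cross (hau t) (β t).2
  -- conclude
  refine Submodule.add_mem _ (hW₁N hw₁W₁) (hT ⟨?_, hw₂⟩)
  have h := Submodule.sub_mem _ hwmax (C.le_maxRatSubHodgeInFilt hW₁ hw₁W₁)
  rwa [add_sub_cancel_left] at h

/-- **The `iff` form of the splitting**: granted `GHC(X, i, r − 1)`, the component of `max(X × S, i + 2, r)` over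
`Hⁱ(X) ⊗ H²(S)` lies in `Nʳ` iff its transcendental part does. [cite: GrothendieckTopology1969, p. 300]
[cite: Huybrechts2016K3, Ch. 3 §3.2–§3.3] -/
theorem maxRatSubHodgeInFilt_inf_kunnethPiece_le_supportedClasses_iff_transcendental {S : Motives.SchemeOver ℂ}
    (hX : IsSmoothProjective n X) (hS : IsSmoothProjective 2 S) (C : HodgeModel (n + 2) (X ⊗ S)) {i k r : ℕ}
    (hk : i + 2 * 1 = k) (hG : 1 ≤ r → GeneralHodgePropertyFor n X i (r - 1)) :
    C.maxRatSubHodgeInFilt k r ⊓ kunnethPiece X S hk ≤ supportedClasses (X ⊗ S) k r ↔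
      C.maxRatSubHodgeInFilt k r ⊓ Submodule.map₂
        ((cupProduct hk).compl₁₂ (complexBetti.map (fst X S) i).hom (complexBetti.map (snd X S) (2 * 1)).hom) ⊤
        (LinearMap.BilinForm.orthogonal
          (cupPairing (complexOrientationFamily hS) (show 2 * 1 + 2 * 1 = 2 * 2 by omega)) (algebraicClasses S 1)) ≤
      supportedClasses (X ⊗ S) k r := by
  refine ⟨fun h ↦ le_trans (inf_le_inf_left _ ?_) h,
    maxRatSubHodgeInFilt_inf_kunnethPiece_le_supportedClasses_of_transcendental hX hS C hk hG⟩
  rw [kunnethPiece_eq_map₂_cross_top_top]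
  exact Submodule.map₂_le_map₂_right le_top

/-! ### §4 `GHC` and `HC` for `X × S`, `S` a surface with `H¹(S) = H³(S) = 0`, modulo the transcendental pieces -/

/-- **`GHC(X × S, k, r)` for a surface `S` with `H¹(S(ℂ); ℂ) = H³(S(ℂ); ℂ) = 0` (K3 surfaces, surfaces with `q = 0`)
from `GHC(X, k, r)`, `GHC(X, k − 2, r − 1)`, `GHC(X, k − 4, r − 2)` and the transcendental pieces of level `r`**:
the Künneth pieces of `X × S` are `Hᵏ(X) ⊗ H⁰(S)`, `H^{k−2}(X) ⊗ H²(S)`, `H^{k−4}(X) ⊗ H⁴(S)`; the outer two are over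
algebraic cohomology (`maxRatSubHodgeInFilt_inf_kunnethPiece_le_supportedClasses_of_algebraic`), the middle one splits
(§3). [cite: GrothendieckTopology1969, p. 300] [cite: Huybrechts2016K3, Ch. 3 §3.2–§3.3]
[cite: VoisinHodgeI2002, §11.3.3 Thm. 11.38 and p. 287] -/
theorem generalHodgePropertyFor_tensor_surface_of_transcendental {S : Motives.SchemeOver ℂ}
    (hX : IsSmoothProjective n X) (hS : IsSmoothProjective 2 S) [Subsingleton (complexBetti S 1)]
    [Subsingleton (complexBetti S 3)] (C : HodgeModel (n + 2) (X ⊗ S)) {k r : ℕ}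
    (h0 : GeneralHodgePropertyFor n X k r) (h1 : GeneralHodgePropertyFor n X (k - 2) (r - 1))
    (h2 : GeneralHodgePropertyFor n X (k - 4) (r - 2))
    (hT : ∀ (i : ℕ) (hk : i + 2 * 1 = k), C.maxRatSubHodgeInFilt k r ⊓ Submodule.map₂
        ((cupProduct hk).compl₁₂ (complexBetti.map (fst X S) i).hom (complexBetti.map (snd X S) (2 * 1)).hom) ⊤
        (LinearMap.BilinForm.orthogonal
          (cupPairing (complexOrientationFamily hS) (show 2 * 1 + 2 * 1 = 2 * 2 by omega)) (algebraicClasses S 1)) ≤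
      supportedClasses (X ⊗ S) k r) :
    GeneralHodgePropertyFor (n + 2) (X ⊗ S) k r := by
  classical
  rw [generalHodgePropertyFor_tensor_iff_forall_inf_kunnethPiece_le' hX hS C k r]
  intro i j hk
  rcases Nat.even_or_odd j with ⟨b, hb⟩ | hj
  · rcases Nat.lt_or_ge 2 b with hb2 | hb2
    · haveI := subsingleton_complexBetti hS (show 2 * 2 < j by omega)
      rw [kunnethPiece_eq_bot_of_subsingleton hk, inf_bot_eq]
      exact bot_le
    · rcases (show b = 0 ∨ b = 1 ∨ b = 2 by omega) with rfl | rfl | rfl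
      · obtain rfl : j = 2 * 0 := by omega
        exact maxRatSubHodgeInFilt_inf_kunnethPiece_le_supportedClasses_of_algebraic hX hS C (show 0 + 2 = 2 by rfl)
          hk (supportedClasses_zero S _) (supportedClasses_eq_top_of_dim_add_le hS (by omega))
          fun _ ↦ by rw [show i = k by omega, Nat.sub_zero]; exact h0
      · obtain rfl : j = 2 * 1 := by omega
        exact maxRatSubHodgeInFilt_inf_kunnethPiece_le_supportedClasses_of_transcendental hX hS C hk
          (fun _ ↦ by rwa [show k - 2 = i by omega] at h1) (hT i hk)
      · obtain rfl : j = 2 * 2 := by omega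
        exact maxRatSubHodgeInFilt_inf_kunnethPiece_le_supportedClasses_of_algebraic hX hS C (show 2 + 0 = 2 by rfl)
          hk (supportedClasses_eq_top_of_dim_add_le hS (by omega)) (supportedClasses_zero S _)
          fun _ ↦ by rwa [show k - 4 = i by omega] at h2
  · have hj' : j = 1 ∨ j = 3 ∨ 2 * 2 < j := by obtain ⟨t, rfl⟩ := hj; omega
    haveI : Subsingleton (complexBetti S j) := by
      rcases hj' with rfl | rfl | hj4
      · infer_instance
      · infer_instance
      · exact subsingleton_complexBetti hS hj4
    rw [kunnethPiece_eq_bot_of_subsingleton hk, inf_bot_eq]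
    exact bot_le

/-- **`HC(X × S)` for a surface `S` with `H¹(S) = H³(S) = 0` from `HC(X)` and the transcendental pieces in the Hodge
bidegrees `(2p, p)`**: by Grothendieck's remark `HC = ∧_p GHC(2p, p)` (`hodgeConjectureFor_of_generalHodgePropertyFor`,
`generalHodgePropertyFor_two_mul_self_of_hodgeConjectureFor`) and §4's `GHC` statement; the remaining input is that
the part of `max(X × S, 2p, p)` (the span of the Hodge classes) inside `H^{2p−2}(X) ⊠ T(S)_ℂ` is algebraic.
[cite: GrothendieckTopology1969, pp. 300–301] [cite: Huybrechts2016K3, Ch. 3 §3.2–§3.3] -/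
theorem hodgeConjectureFor_tensor_surface_of_transcendental {S : Motives.SchemeOver ℂ}
    (hX : IsSmoothProjective n X) (hS : IsSmoothProjective 2 S) [Subsingleton (complexBetti S 1)]
    [Subsingleton (complexBetti S 3)] (C : HodgeModel (n + 2) (X ⊗ S)) (h : HodgeConjectureFor n X)
    (hT : ∀ (p i : ℕ) (hk : i + 2 * 1 = 2 * p), C.maxRatSubHodgeInFilt (2 * p) p ⊓ Submodule.map₂
        ((cupProduct hk).compl₁₂ (complexBetti.map (fst X S) i).hom (complexBetti.map (snd X S) (2 * 1)).hom) ⊤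
        (LinearMap.BilinForm.orthogonal
          (cupPairing (complexOrientationFamily hS) (show 2 * 1 + 2 * 1 = 2 * 2 by omega)) (algebraicClasses S 1)) ≤
      supportedClasses (X ⊗ S) (2 * p) p) :
    HodgeConjectureFor (n + 2) (X ⊗ S) := by
  refine hodgeConjectureFor_of_generalHodgePropertyFor fun p ↦
    generalHodgePropertyFor_tensor_surface_of_transcendental hX hS C
      (generalHodgePropertyFor_two_mul_self_of_hodgeConjectureFor hX h p) ?_ ?_ (hT p)
  · rcases Nat.eq_zero_or_pos p with rfl | hp
    · simpa using generalHodgePropertyFor_two_mul_self_of_hodgeConjectureFor hX h 0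
    · simpa [show 2 * p - 2 = 2 * (p - 1) by omega] using
        generalHodgePropertyFor_two_mul_self_of_hodgeConjectureFor hX h (p - 1)
  · rcases Nat.lt_or_ge p 2 with hp | hp
    · have h0 := generalHodgePropertyFor_two_mul_self_of_hodgeConjectureFor hX h 0
      rcases (show p = 0 ∨ p = 1 by omega) with rfl | rfl
      · simpa using h0
      · simpa using h0
    · simpa [show 2 * p - 4 = 2 * (p - 2) by omega] using
        generalHodgePropertyFor_two_mul_self_of_hodgeConjectureFor hX h (p - 2)

/-! ### §5 The `iff` forms, with the known bidegrees discharged -/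

/-- `HC(X × S) ⟹` every piece of `max(X × S, 2p, p)` lies in `Nᵖ`. [cite: GrothendieckTopology1969, pp. 300–301] -/
theorem HodgeConjectureFor.maxRatSubHodgeInFilt_inf_le_supportedClasses {Z : Motives.SchemeOver ℂ} {d : ℕ}
    (hZ : IsSmoothProjective d Z) (h : HodgeConjectureFor d Z) (C : HodgeModel d Z) (p : ℕ)
    (U : Submodule ℂ (complexBetti Z (2 * p))) :
    C.maxRatSubHodgeInFilt (2 * p) p ⊓ U ≤ supportedClasses Z (2 * p) p :=
  inf_le_left.trans ((generalHodgePropertyFor_iff_of_hodgeModel C hZ (2 * p) p).1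
    (generalHodgePropertyFor_two_mul_self_of_hodgeConjectureFor hZ h p))

/-- **`HC(X × S) ⟺ THE TRANSCENDENTAL PIECES**, for a surface `S` with `H¹(S) = H³(S) = 0` and `X` satisfying `HC`:
`HC(X × S)` holds iff for every `2 ≤ p ≤ dim X` the part of `max(X × S, 2p, p)` inside `H^{2p−2}(X) ⊠ T(S)_ℂ` lies in
`Nᵖ` (the bidegrees `p ≤ 1` and `p ≥ dim X + 1` of `X × S` are Lefschetz `(1,1)` / curve classes,
`generalHodgePropertyFor_two_mul_self_of_lefschetzRange`). [cite: GrothendieckTopology1969, pp. 300–301]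
[cite: Huybrechts2016K3, Ch. 3 §3.2–§3.3] [cite: VoisinHodgeI2002, Thm. 11.30 and §11.3.3] -/
theorem hodgeConjectureFor_tensor_surface_iff_transcendental {S : Motives.SchemeOver ℂ}
    (hX : IsSmoothProjective n X) (hS : IsSmoothProjective 2 S) [Subsingleton (complexBetti S 1)]
    [Subsingleton (complexBetti S 3)] (C : HodgeModel (n + 2) (X ⊗ S)) (h : HodgeConjectureFor n X) :
    HodgeConjectureFor (n + 2) (X ⊗ S) ↔
      ∀ p : ℕ, 2 ≤ p → p ≤ n → ∀ (i : ℕ) (hk : i + 2 * 1 = 2 * p), C.maxRatSubHodgeInFilt (2 * p) p ⊓ Submodule.map₂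
        ((cupProduct hk).compl₁₂ (complexBetti.map (fst X S) i).hom (complexBetti.map (snd X S) (2 * 1)).hom) ⊤
        (LinearMap.BilinForm.orthogonal
          (cupPairing (complexOrientationFamily hS) (show 2 * 1 + 2 * 1 = 2 * 2 by omega)) (algebraicClasses S 1)) ≤
      supportedClasses (X ⊗ S) (2 * p) p := by
  have hXS := hX.tensor_holds hS
  refine ⟨fun hXS' p _ _ i hk ↦ hXS'.maxRatSubHodgeInFilt_inf_le_supportedClasses hXS C p _, fun hT ↦ ?_⟩
  refine hodgeConjectureFor_of_generalHodgePropertyFor fun p ↦ ?_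
  by_cases hp : p ≤ 1 ∨ n + 2 ≤ p + 1
  · exact generalHodgePropertyFor_two_mul_self_of_lefschetzRange hXS hp
  · have hp2 : 2 ≤ p := by omega
    have hpn : p ≤ n := by omega
    refine generalHodgePropertyFor_tensor_surface_of_transcendental hX hS C
      (generalHodgePropertyFor_two_mul_self_of_hodgeConjectureFor hX h p) ?_ ?_ (hT p hp2 hpn)
    · simpa [show 2 * p - 2 = 2 * (p - 1) by omega] using
        generalHodgePropertyFor_two_mul_self_of_hodgeConjectureFor hX h (p - 1)
    · simpa [show 2 * p - 4 = 2 * (p - 2) by omega] using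
        generalHodgePropertyFor_two_mul_self_of_hodgeConjectureFor hX h (p - 2)

/-- **THE HODGE CONJECTURE FOR A PRODUCT OF TWO SURFACES REDUCES TO `H²(S₁) ⊗ T(S₂)`**: for smooth projective surfaces
`S₁`, `S₂` with `H¹(S₂) = H³(S₂) = 0` (e.g. `S₂` a K3 surface), `HC(S₁ × S₂)` holds iff the part of `max(S₁ × S₂, 4, 2)`
(the span of the Hodge classes of `H⁴`) inside `H²(S₁) ⊠ T(S₂)_ℂ` consists of classes of algebraic `2`-cycles — all the
other Künneth and Néron–Severi parts are algebraic unconditionally (`HC(S₁)` by Lefschetz `(1,1)`,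
`hodgeConjectureFor_of_dim_le_three_holds`). [cite: GrothendieckTopology1969, pp. 300–301]
[cite: Huybrechts2016K3, Ch. 3 §3.2–§3.3] [cite: Hartshorne1977, V Thm. 1.9 and V Rem. 1.9.1]
[cite: VoisinHodgeI2002, Thm. 11.30 and §11.3.3] -/
theorem hodgeConjectureFor_surface_tensor_surface_iff_transcendental {S₁ S₂ : Motives.SchemeOver ℂ}
    (hS₁ : IsSmoothProjective 2 S₁) (hS₂ : IsSmoothProjective 2 S₂) [Subsingleton (complexBetti S₂ 1)]
    [Subsingleton (complexBetti S₂ 3)] (C : HodgeModel (2 + 2) (S₁ ⊗ S₂)) :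
    HodgeConjectureFor (2 + 2) (S₁ ⊗ S₂) ↔
      C.maxRatSubHodgeInFilt (2 * 2) 2 ⊓ Submodule.map₂
        ((cupProduct (show 2 + 2 * 1 = 2 * 2 by omega)).compl₁₂ (complexBetti.map (fst S₁ S₂) 2).hom
          (complexBetti.map (snd S₁ S₂) (2 * 1)).hom) ⊤
        (LinearMap.BilinForm.orthogonal
          (cupPairing (complexOrientationFamily hS₂) (show 2 * 1 + 2 * 1 = 2 * 2 by omega)) (algebraicClasses S₂ 1)) ≤
      supportedClasses (S₁ ⊗ S₂) (2 * 2) 2 := by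
  rw [hodgeConjectureFor_tensor_surface_iff_transcendental hS₁ hS₂ C (hodgeConjectureFor_of_dim_le_three_holds (by omega) hS₁)]
  refine ⟨fun h ↦ h 2 le_rfl le_rfl 2 (by omega), fun h p hp2 hp22 i hk ↦ ?_⟩
  obtain rfl : p = 2 := le_antisymm hp22 hp2
  obtain rfl : i = 2 := by omega
  exact h

/-- **`HC(X × S)` for a threefold `X` and a surface `S` with `H¹(S) = H³(S) = 0` ⟺ the two transcendental pieces
`H²(X) ⊠ T(S)_ℂ` at `(4, 2)` and `H⁴(X) ⊠ T(S)_ℂ` at `(6, 3)`** (`HC(X)` holds for threefolds,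
`hodgeConjectureFor_of_dim_le_three_holds`). [cite: GrothendieckTopology1969, pp. 300–301]
[cite: Huybrechts2016K3, Ch. 3 §3.2–§3.3] [cite: VoisinHodgeII2003, §10.2.3 proof of Prop. 10.26] -/
theorem hodgeConjectureFor_threefold_tensor_surface_iff_transcendental {S : Motives.SchemeOver ℂ}
    (hX : IsSmoothProjective 3 X) (hS : IsSmoothProjective 2 S) [Subsingleton (complexBetti S 1)]
    [Subsingleton (complexBetti S 3)] (C : HodgeModel (3 + 2) (X ⊗ S)) :
    HodgeConjectureFor (3 + 2) (X ⊗ S) ↔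
      (C.maxRatSubHodgeInFilt (2 * 2) 2 ⊓ Submodule.map₂
        ((cupProduct (show 2 + 2 * 1 = 2 * 2 by omega)).compl₁₂ (complexBetti.map (fst X S) 2).hom
          (complexBetti.map (snd X S) (2 * 1)).hom) ⊤
        (LinearMap.BilinForm.orthogonal
          (cupPairing (complexOrientationFamily hS) (show 2 * 1 + 2 * 1 = 2 * 2 by omega)) (algebraicClasses S 1)) ≤
      supportedClasses (X ⊗ S) (2 * 2) 2) ∧
      C.maxRatSubHodgeInFilt (2 * 3) 3 ⊓ Submodule.map₂
        ((cupProduct (show 4 + 2 * 1 = 2 * 3 by omega)).compl₁₂ (complexBetti.map (fst X S) 4).hom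
          (complexBetti.map (snd X S) (2 * 1)).hom) ⊤
        (LinearMap.BilinForm.orthogonal
          (cupPairing (complexOrientationFamily hS) (show 2 * 1 + 2 * 1 = 2 * 2 by omega)) (algebraicClasses S 1)) ≤
      supportedClasses (X ⊗ S) (2 * 3) 3 := by
  rw [hodgeConjectureFor_tensor_surface_iff_transcendental hX hS C (hodgeConjectureFor_of_dim_le_three_holds le_rfl hX)]
  refine ⟨fun h ↦ ⟨h 2 le_rfl (by omega) 2 (by omega), h 3 (by omega) le_rfl 4 (by omega)⟩, fun h p hp2 hp3 i hk ↦ ?_⟩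
  rcases (show p = 2 ∨ p = 3 by omega) with rfl | rfl
  · obtain rfl : i = 2 := by omega
    exact h.1
  · obtain rfl : i = 4 := by omega
    exact h.2

/-- **GROTHENDIECK'S `GHC` FOR `C × S` IN EVERY BIDEGREE ⟺ ITS TRANSCENDENTAL PIECE `H¹(C) ⊗ T(S)_ℂ`**: for a smooth
projective curve `C` and a surface `S` with `H¹(S) = H³(S) = 0`, `GHC(C × S, i, r)` holds for all `(i, r)` iff the part
of `max(C × S, 3, 1)` inside `H¹(C) ⊠ T(S)_ℂ` is supported on a divisor (the window of the threefold `C × S` is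
`(3, 1)`, `generalHodgePropertyFor_of_dim_three`; its Künneth pieces other than `H¹(C) ⊗ H²(S)` vanish, and the
Néron–Severi part of that piece is settled by the trivial `GHC(C, 1, 0)`). [cite: GrothendieckTopology1969, pp. 300–301]
[cite: Huybrechts2016K3, Ch. 3 §3.2–§3.3] [cite: Hartshorne1977, V Thm. 1.9 and V Rem. 1.9.1] -/
theorem forall_generalHodgePropertyFor_curve_tensor_surface_iff_transcendental {C₀ S : Motives.SchemeOver ℂ}
    (hC : IsSmoothProjective 1 C₀) (hS : IsSmoothProjective 2 S) [Subsingleton (complexBetti S 1)]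
    [Subsingleton (complexBetti S 3)] (C : HodgeModel (1 + 2) (C₀ ⊗ S)) :
    (∀ i r : ℕ, GeneralHodgePropertyFor 3 (C₀ ⊗ S) i r) ↔
      C.maxRatSubHodgeInFilt 3 1 ⊓ Submodule.map₂
        ((cupProduct (show 1 + 2 * 1 = 3 by omega)).compl₁₂ (complexBetti.map (fst C₀ S) 1).hom
          (complexBetti.map (snd C₀ S) (2 * 1)).hom) ⊤
        (LinearMap.BilinForm.orthogonal
          (cupPairing (complexOrientationFamily hS) (show 2 * 1 + 2 * 1 = 2 * 2 by omega)) (algebraicClasses S 1)) ≤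
      supportedClasses (C₀ ⊗ S) 3 1 := by
  classical
  have hCS : IsSmoothProjective 3 (C₀ ⊗ S) := hC.tensor_holds hS
  refine ⟨fun h ↦ inf_le_left.trans ((generalHodgePropertyFor_iff_of_hodgeModel C hCS 3 1).1 (h 3 1)), fun hT i r ↦ ?_⟩
  by_cases hw : i ≠ 3 ∨ r ≠ 1
  · exact generalHodgePropertyFor_of_dim_three hCS hw
  · obtain ⟨rfl, rfl⟩ : i = 3 ∧ r = 1 := by
      constructor <;> by_contra h' <;> simp_all
    rw [generalHodgePropertyFor_tensor_iff_forall_inf_kunnethPiece_le' hC hS C 3 1]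
    intro i j hk
    rcases (show j = 0 ∨ j = 1 ∨ j = 2 ∨ j = 3 by omega) with rfl | rfl | rfl | rfl
    · obtain rfl : i = 3 := by omega
      haveI := subsingleton_complexBetti hC (show 2 * 1 < 3 by omega)
      rw [kunnethPiece_eq_bot_of_subsingleton_left hk, inf_bot_eq]
      exact bot_le
    · rw [kunnethPiece_eq_bot_of_subsingleton hk, inf_bot_eq]
      exact bot_le
    · obtain rfl : i = 1 := by omega
      exact maxRatSubHodgeInFilt_inf_kunnethPiece_le_supportedClasses_of_transcendental hC hS C hk
        (fun _ ↦ generalHodgePropertyFor_of_dim_le_two (by omega) hC 1 (1 - 1)) hT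
    · rw [kunnethPiece_eq_bot_of_subsingleton hk, inf_bot_eq]
      exact bot_le

end Literature.AlgebraicGeometry.HodgeTheory

end
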